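/-
Copyright (c) 2026. All rights reserved.
Released under Apache 2.0 license as described in the file LICENSE.
Authors: abc-iut cell — seat abc-iut-f-100 (F fact-proving wave, tranche 100; FACT-LIST rows F-2665 /
F-2666): PROOF-ONLY companion to `HolomorphicCoresLocalLinearProofs.lean` (abc-iut-w4-d104), no definitions.
-/
import Literature.AnabelianGeometry.AbsoluteAnabelian.HolomorphicCoresLocalLinearProofs
import HarnessLib

/-!
# [AbsTopIII] Prop 2.6 (a): the germ conditions `PreservesOrthFrames` / `PreservesOrientation` — their exact
# extension, instances, independence, and the (refutable) universal closures (FACT-LIST F-2665 / F-2666)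

S. Mochizuki, *Topics in absolute anabelian geometry III: global reconstruction algorithms*, J. Math. Sci.
Univ. Tokyo 22 (2015) [MochizukiAbsTopIII2015], Prop. 2.6 (a), kurims manuscript p. 57:

> (a) For `p ∈ U`, write `𝒜_p` for the group of automorphisms of the projective system of connected open
> neighborhoods of `p` in `U` that are compatible with the "local additive structures" of Proposition 2.5,
> (e), and preserve the orthogonal frames and orientations [at `p`] of Proposition 2.5, (d); Remark 2.5.1.
> […] Then we have a natural isomorphism of topological groups `ℂ^× ⥲ 𝒜_p` […].

The two FACT-LIST rows **F-2665** `LocGerm.PreservesOrthFrames` and **F-2666** `LocGerm.PreservesOrientation`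
(file `HolomorphicCoresLocalLinearProofs.lean`, seat abc-iut-w4-d104) are NOT closed statements: they are the
second and third printed CONDITIONS on a germ `F : LocGerm p` cutting out `𝒜_p = germAut p` — PARAMETRISED
PREDICATES (binders `p : ℂ`, `F : LocGerm p`).  Their bridge to the abstract notions of Prop. 2.5 (d) /
Rmk. 2.5.1 is landed (`LocGerm.preservesOrthFrames_iff_orthogonalFrames`,
`LocGerm.preservesOrientation_iff_orientations`, `mem_germAut_iff_abstract`).  This file records, as kernel
objects and with nothing restated:

* the EXACT EXTENSION of each predicate in closed form — `LocGerm.preservesOrthFrames_iff`: a germ preserves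
  the orthogonal frames at `p` iff it is the germ of a similarity `z ↦ p + c (z − p)` or of an anti-similarity
  `z ↦ p + c · conj (z − p)` (`c ∈ ℂ`, the degenerate `c = 0` included), resting on the classical
  classification `LocGerm.orthogonal_iff_exists_eq_mul_or_eq_mul_conj` of the `ℝ`-linear self-maps of `ℂ`
  taking right angles to right angles; `LocGerm.PreservesOrientation` is by definition "affine with
  `det > 0`" (`LocGerm.preservesOrientation_linGerm_iff`, landed); jointly,
  `LocGerm.preservesOrthFrames_and_preservesOrientation_iff`: BOTH hold iff `F = mulGerm p c`, `c ≠ 0` —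
  the rigidity behind `ℂ^× ⥲ 𝒜_p` read on the two predicates alone (each already forces additive
  compatibility, `PreservesOrthFrames.isAddCompat`, `PreservesOrientation.isAddCompat`);
* INSTANCE FORMS with the predicate as conclusion head: `preservesOrthFrames_mulGerm` (every `c`),
  `preservesOrientation_mulGerm` (`c ≠ 0`), `…_one`, the conjugation germs `preservesOrthFrames_conjSmul` /
  `not_preservesOrientation_conjSmul`, the shear germ `preservesOrientation_shear` / `not_preservesOrthFrames_shear`;
* INDEPENDENCE inside the ambient group of Prop. 2.6 (a) (units of `LocGerm p` = automorphisms of the projective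
  system of neighbourhoods of `p`): there are additively compatible UNITS preserving the orthogonal frames but
  not the orientations (`exists_unit_preservesOrthFrames_not_preservesOrientation`) and units preserving the
  orientations but not the orthogonal frames (`exists_unit_preservesOrientation_not_preservesOrthFrames`) — so
  neither printed condition is idle in the definition of `𝒜_p`;
* hence the UNIVERSAL CLOSURES of both rows are FALSE (`not_forall_preservesOrthFrames`,
  `not_forall_preservesOrientation`, also over units): each row is admissible only in its instance / bridge
  form (FACT-LIST class «universal-closure REFUTED; instance forms PROVED»), never as `∀ p F, …`.

Refereed pre-IUT material, elementary plane geometry; nothing here bears on the disputed [IUTchIII] Cor. 3.12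
or takes a side; typed ≠ endorsed; a refuted closure is never a fact.
-/

noncomputable section

namespace Literature.AnabelianGeometry.AbsoluteAnabelian

open _root_.Complex
open scoped InnerProductSpace ComplexConjugate

namespace LocGerm

variable {p : ℂ}

/-! ### Both conditions force an affine germ -/

/-- A germ preserving the orthogonal frames at `p` is an affine germ, hence compatible with the local
additive structure. [cite: MochizukiAbsTopIII2015, Proposition 2.6 (a) p.57] -/
theorem PreservesOrthFrames.isAddCompat {F : LocGerm p} (h : F.PreservesOrthFrames) : F.IsAddCompat := by
  obtain ⟨L, hL, -⟩ := h
  exact isAddCompat_iff.2 ⟨L, hL⟩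

/-- A germ preserving the orientations at `p` is an affine germ, hence compatible with the local additive
structure. [cite: MochizukiAbsTopIII2015, Proposition 2.6 (a) p.57] -/
theorem PreservesOrientation.isAddCompat {F : LocGerm p} (h : F.PreservesOrientation) : F.IsAddCompat := by
  obtain ⟨L, hL, -⟩ := h
  exact isAddCompat_iff.2 ⟨L, hL⟩

/-! ### Right angles to right angles: similarities and anti-similarities -/

/-- Complex conjugation is a real isometry: it preserves real inner products. (Auxiliary.)
[cite: MochizukiAbsTopIII2015, Proposition 2.6 (proof) pp.57–58] -/
theorem inner_conj_conj (u v : ℂ) : ⟪conj u, conj v⟫_ℝ = ⟪u, v⟫_ℝ := by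
  rw [Complex.inner, Complex.inner]
  simp only [Complex.mul_re, Complex.conj_re, Complex.conj_im]
  ring

/-- **Classification of the `ℝ`-linear self-maps of `ℂ` taking right angles to right angles** (the linear
algebra behind "preserve the orthogonal frames", Rmk. 2.5.1): `L` maps orthogonal pairs to orthogonal pairs
iff `L` is a similarity `z ↦ c z` or an anti-similarity `z ↦ c · conj z` for some `c ∈ ℂ` (`c = 0` allowed).
Test pairs `1 ⊥ i` and `1 + i ⊥ 1 − i` give `L 1 ⊥ L i`, `|L 1| = |L i|`, whence `L i = ± i · L 1`.
[cite: MochizukiAbsTopIII2015, Proposition 2.6 (a) p.57] -/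
theorem orthogonal_iff_exists_eq_mul_or_eq_mul_conj (L : ℂ →L[ℝ] ℂ) :
    (∀ u v : ℂ, ⟪u, v⟫_ℝ = 0 → ⟪L u, L v⟫_ℝ = 0) ↔
      ∃ c : ℂ, (∀ z, L z = c * z) ∨ (∀ z, L z = c * conj z) := by
  constructor
  · intro horth
    set a := L 1 with ha
    set b := L I with hb
    have h1 : ⟪(1 : ℂ), I⟫_ℝ = 0 := by simp [Complex.inner]
    have h2 : ⟪(1 : ℂ) + I, 1 - I⟫_ℝ = 0 := by simp [Complex.inner]
    have hab : ⟪a, b⟫_ℝ = 0 := horth _ _ h1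
    have hab' : ⟪a + b, a - b⟫_ℝ = 0 := by
      have := horth _ _ h2
      rwa [map_add, map_sub] at this
    rw [Complex.inner] at hab hab'
    have e1 : b.re * a.re + b.im * a.im = 0 := by
      simpa [Complex.mul_re, Complex.conj_re, Complex.conj_im] using hab
    have e2 : a.re ^ 2 + a.im ^ 2 = b.re ^ 2 + b.im ^ 2 := by
      have h := hab'
      simp [Complex.mul_re, Complex.conj_re, Complex.conj_im] at h
      nlinarith [h]
    -- Lagrange's identity: the determinant is `± |a|²`
    have hlag : (a.re * b.im - a.im * b.re) ^ 2 + (b.re * a.re + b.im * a.im) ^ 2 =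
        (a.re ^ 2 + a.im ^ 2) * (b.re ^ 2 + b.im ^ 2) := by ring
    rw [e1, ← e2] at hlag
    have hD : a.re * b.im - a.im * b.re = a.re ^ 2 + a.im ^ 2 ∨
        a.re * b.im - a.im * b.re = -(a.re ^ 2 + a.im ^ 2) := by
      apply sq_eq_sq_iff_eq_or_eq_neg.1
      nlinarith [hlag]
    rcases hD with hD | hD
    · -- `L i = i · L 1`: a similarity
      have hbre : b.re = -a.im := by
        nlinarith [sq_nonneg (b.re + a.im), sq_nonneg (b.im - a.re)]
      have hbim : b.im = a.re := by
        nlinarith [sq_nonneg (b.re + a.im), sq_nonneg (b.im - a.re)]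
      refine ⟨a, Or.inl fun z => ?_⟩
      rw [clm_apply_eq L z, ← ha, ← hb]
      apply Complex.ext
      · simp [Complex.mul_re, hbre]
        ring
      · simp [Complex.mul_im, hbim]
        ring
    · -- `L i = -i · L 1`: an anti-similarity
      have hbre : b.re = a.im := by
        nlinarith [sq_nonneg (b.re - a.im), sq_nonneg (b.im + a.re)]
      have hbim : b.im = -a.re := by
        nlinarith [sq_nonneg (b.re - a.im), sq_nonneg (b.im + a.re)]
      refine ⟨a, Or.inr fun z => ?_⟩
      rw [clm_apply_eq L z, ← ha, ← hb]
      apply Complex.ext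
      · simp [Complex.mul_re, Complex.conj_re, Complex.conj_im, hbre]
        ring
      · simp [Complex.mul_im, Complex.conj_re, Complex.conj_im, hbim]
        ring
  · rintro ⟨c, hc | hc⟩ u v huv
    · rw [hc, hc, inner_mul_left_mul_left, huv, mul_zero]
    · rw [hc, hc, inner_mul_left_mul_left, inner_conj_conj, huv, mul_zero]

/-- The anti-similarity `z ↦ c · conj z` as a continuous `ℝ`-linear map is `c • conjCLE`. (Auxiliary.)
[cite: MochizukiAbsTopIII2015, Proposition 2.6 (proof) pp.57–58] -/
theorem smul_conjCLE_apply (c z : ℂ) : (c • (conjCLE : ℂ →L[ℝ] ℂ)) z = c * conj z := by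
  simp

/-- The similarity `z ↦ c z` as a continuous `ℝ`-linear map is `c • id`. (Auxiliary.)
[cite: MochizukiAbsTopIII2015, Proposition 2.6 (proof) pp.57–58] -/
theorem smul_id_apply (c z : ℂ) : (c • ContinuousLinearMap.id ℝ ℂ) z = c * z := by
  simp

/-- The determinant of `z ↦ c · conj z` is `−|c|²`. (Auxiliary.)
[cite: MochizukiAbsTopIII2015, Proposition 2.6 (proof) pp.57–58] -/
theorem det_smul_conjCLE (c : ℂ) :
    LinearMap.det ((c • (conjCLE : ℂ →L[ℝ] ℂ) : ℂ →L[ℝ] ℂ) : ℂ →ₗ[ℝ] ℂ) = -Complex.normSq c := by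
  rw [det_eq_of_clm, smul_conjCLE_apply, smul_conjCLE_apply]
  simp [Complex.normSq_apply, Complex.mul_re, Complex.mul_im]
  ring

/-! ### The exact extension of `PreservesOrthFrames` -/

/-- **F-2665, extension in closed form.** A local germ at `p` preserves the orthogonal frames at `p`
(`LocGerm.PreservesOrthFrames`, Prop. 2.6 (a) / Rmk. 2.5.1) IFF it is the germ of a similarity
`z ↦ p + c (z − p)` (`mulGerm p c`) or of an anti-similarity `z ↦ p + c · conj (z − p)`, for some `c ∈ ℂ`
(the degenerate `c = 0`, the constant germ, included: it is not a unit).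
[cite: MochizukiAbsTopIII2015, Proposition 2.6 (a) p.57] -/
theorem preservesOrthFrames_iff (F : LocGerm p) :
    F.PreservesOrthFrames ↔
      ∃ c : ℂ, F = mulGerm p c ∨ F = linGerm p (c • (conjCLE : ℂ →L[ℝ] ℂ)) := by
  constructor
  · rintro ⟨L, hF, horth⟩
    obtain ⟨c, hc | hc⟩ := (orthogonal_iff_exists_eq_mul_or_eq_mul_conj L).1 horth
    · refine ⟨c, Or.inl ?_⟩
      rw [hF, mulGerm_eq_linGerm]
      congr 1
      ext1 z
      rw [hc, smul_id_apply]
    · refine ⟨c, Or.inr ?_⟩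
      rw [hF]
      congr 1
      ext1 z
      rw [hc, smul_conjCLE_apply]
  · rintro ⟨c, hF | hF⟩
    · rw [hF, mulGerm_eq_linGerm]
      refine ⟨_, rfl, (orthogonal_iff_exists_eq_mul_or_eq_mul_conj _).2 ⟨c, Or.inl fun z => ?_⟩⟩
      exact smul_id_apply c z
    · rw [hF]
      refine ⟨_, rfl, (orthogonal_iff_exists_eq_mul_or_eq_mul_conj _).2 ⟨c, Or.inr fun z => ?_⟩⟩
      exact smul_conjCLE_apply c z

/-! ### Instance forms -/

/-- **F-2665, instance:** every similarity germ `z ↦ p + c (z − p)` preserves the orthogonal frames at `p`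
(for every `c`, also `c = 0`). [cite: MochizukiAbsTopIII2015, Proposition 2.6 (a) p.57] -/
theorem preservesOrthFrames_mulGerm (c : ℂ) : (mulGerm p c).PreservesOrthFrames :=
  (preservesOrthFrames_iff _).2 ⟨c, Or.inl rfl⟩

/-- **F-2666, instance:** the similarity germ `z ↦ p + c (z − p)` preserves the orientations at `p` iff
`c ≠ 0` (its determinant is `|c|²`). [cite: MochizukiAbsTopIII2015, Proposition 2.6 (a) p.57] -/
theorem preservesOrientation_mulGerm_iff (c : ℂ) : (mulGerm p c).PreservesOrientation ↔ c ≠ 0 := by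
  rw [mulGerm_eq_linGerm]
  constructor
  · rintro ⟨L, hL, hdet⟩ rfl
    obtain rfl := linGerm_injective p hL
    rw [det_mulLeft, map_zero] at hdet
    exact lt_irrefl _ hdet
  · intro hc
    refine ⟨_, rfl, ?_⟩
    rw [det_mulLeft]
    exact Complex.normSq_pos.2 hc

/-- **F-2666, instance:** for `c ≠ 0` the similarity germ `z ↦ p + c (z − p)` preserves the orientations at
`p`. [cite: MochizukiAbsTopIII2015, Proposition 2.6 (a) p.57] -/
theorem preservesOrientation_mulGerm {c : ℂ} (hc : c ≠ 0) : (mulGerm p c).PreservesOrientation :=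
  (preservesOrientation_mulGerm_iff c).2 hc

/-- **F-2665, instance:** the identity germ preserves the orthogonal frames.
[cite: MochizukiAbsTopIII2015, Proposition 2.6 (a) p.57] -/
theorem preservesOrthFrames_one : (1 : LocGerm p).PreservesOrthFrames := by
  rw [← mulGerm_one]
  exact preservesOrthFrames_mulGerm 1

/-- **F-2666, instance:** the identity germ preserves the orientations.
[cite: MochizukiAbsTopIII2015, Proposition 2.6 (a) p.57] -/
theorem preservesOrientation_one : (1 : LocGerm p).PreservesOrientation := by
  rw [← mulGerm_one]
  exact preservesOrientation_mulGerm one_ne_zero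

/-- **F-2665, instance:** every anti-similarity germ `z ↦ p + c · conj (z − p)` preserves the orthogonal
frames at `p`. [cite: MochizukiAbsTopIII2015, Proposition 2.6 (a) p.57] -/
theorem preservesOrthFrames_conjSmul (c : ℂ) :
    (linGerm p (c • (conjCLE : ℂ →L[ℝ] ℂ))).PreservesOrthFrames :=
  (preservesOrthFrames_iff _).2 ⟨c, Or.inr rfl⟩

/-- **F-2666, non-instance:** no anti-similarity germ `z ↦ p + c · conj (z − p)` preserves the orientations at
`p` (its determinant is `−|c|² ≤ 0`). [cite: MochizukiAbsTopIII2015, Proposition 2.6 (a) p.57] -/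
theorem not_preservesOrientation_conjSmul (c : ℂ) :
    ¬ (linGerm p (c • (conjCLE : ℂ →L[ℝ] ℂ))).PreservesOrientation := by
  rintro ⟨L, hL, hdet⟩
  obtain rfl := linGerm_injective p hL
  rw [det_smul_conjCLE] at hdet
  have := Complex.normSq_nonneg c
  linarith

/-- The shear `z ↦ z + (re z) · i` fixes `i` and sends `1 ↦ 1 + i`. (Auxiliary.)
[cite: MochizukiAbsTopIII2015, Proposition 2.6 (proof) pp.57–58] -/
theorem shear_apply (z : ℂ) :
    (ContinuousLinearMap.id ℝ ℂ + reCLM.smulRight I) z = z + (z.re : ℂ) * I := by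
  simp [Complex.reCLM_apply]

/-- **F-2666, instance:** the shear germ `z ↦ p + S (z − p)`, `S z = z + (re z) · i` (`det S = 1`), preserves
the orientations at `p`. [cite: MochizukiAbsTopIII2015, Proposition 2.6 (a) p.57] -/
theorem preservesOrientation_shear :
    (linGerm p (ContinuousLinearMap.id ℝ ℂ + reCLM.smulRight I)).PreservesOrientation := by
  refine ⟨_, rfl, ?_⟩
  rw [det_eq_of_clm, shear_apply, shear_apply]
  norm_num

/-- **F-2665, non-instance:** the shear germ does NOT preserve the orthogonal frames at `p`: `1 ⊥ i` but
`S 1 = 1 + i` is not orthogonal to `S i = i`. [cite: MochizukiAbsTopIII2015, Proposition 2.6 (a) p.57] -/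
theorem not_preservesOrthFrames_shear :
    ¬ (linGerm p (ContinuousLinearMap.id ℝ ℂ + reCLM.smulRight I)).PreservesOrthFrames := by
  rintro ⟨L, hL, horth⟩
  obtain rfl := linGerm_injective p hL
  have h1 : ⟪(1 : ℂ), I⟫_ℝ = 0 := by simp [Complex.inner]
  have h := horth _ _ h1
  rw [shear_apply, shear_apply, Complex.inner] at h
  norm_num [Complex.mul_re] at h

/-! ### The joint extension: rigidity on the two predicates alone -/

/-- **F-2665 ∧ F-2666, joint extension.** A local germ at `p` preserves BOTH the orthogonal frames and the
orientations at `p` iff it is the similarity germ `z ↦ p + c (z − p)` of some `c ∈ ℂ^×` — the rigidity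
`exists_eq_mulGerm_of_compat` behind `ℂ^× ⥲ 𝒜_p`, with the additive compatibility now READ OFF the two
predicates (`PreservesOrthFrames.isAddCompat`). [cite: MochizukiAbsTopIII2015, Proposition 2.6 (a) p.57] -/
theorem preservesOrthFrames_and_preservesOrientation_iff (F : LocGerm p) :
    F.PreservesOrthFrames ∧ F.PreservesOrientation ↔ ∃ c : ℂ, c ≠ 0 ∧ F = mulGerm p c := by
  constructor
  · rintro ⟨h₂, h₃⟩
    exact exists_eq_mulGerm_of_compat h₂.isAddCompat h₂ h₃
  · rintro ⟨c, hc, rfl⟩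
    exact ⟨preservesOrthFrames_mulGerm c, preservesOrientation_mulGerm hc⟩

/-- In terms of `𝒜_p`: a UNIT of the germ monoid lies in `germAut p` iff it satisfies the second and third
printed conditions (the first, additive compatibility, follows).
[cite: MochizukiAbsTopIII2015, Proposition 2.6 (a) p.57] -/
theorem mem_germAut_iff_preserves (u : (LocGerm p)ˣ) :
    u ∈ germAut p ↔ (u : LocGerm p).PreservesOrthFrames ∧ (u : LocGerm p).PreservesOrientation := by
  rw [mem_germAut]
  exact ⟨fun h => h.2, fun h => ⟨h.1.isAddCompat, h⟩⟩

/-! ### Independence of the two conditions inside the ambient automorphism group -/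

/-- The germ of an involutive continuous `ℝ`-linear map is a unit of the germ monoid (its own inverse).
(Auxiliary.) [cite: MochizukiAbsTopIII2015, Proposition 2.6 (proof) pp.57–58] -/
theorem linGerm_mul_self_of_involutive {L : ℂ →L[ℝ] ℂ} (hL : ∀ z, L (L z) = z) :
    linGerm p L * linGerm p L = 1 := by
  rw [linGerm_mul, ← linGerm_id]
  congr 1
  ext1 z
  simp [hL z]

/-- **Independence, I (F-2665 ⇏ F-2666):** at every `p` there is an automorphism of the projective system of
neighbourhoods of `p` (a unit of `LocGerm p`), compatible with the local additive structure and preserving the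
orthogonal frames, which does NOT preserve the orientations — the conjugation germ `z ↦ p + conj (z − p)`.  So
the orientation condition in the definition of `𝒜_p` is not idle. [cite: MochizukiAbsTopIII2015, Proposition 2.6 (a) p.57] -/
theorem exists_unit_preservesOrthFrames_not_preservesOrientation (p : ℂ) :
    ∃ u : (LocGerm p)ˣ, (u : LocGerm p).IsAddCompat ∧ (u : LocGerm p).PreservesOrthFrames ∧
      ¬ (u : LocGerm p).PreservesOrientation ∧ u ∉ germAut p := by
  have hinv : ∀ z, (conjCLE : ℂ →L[ℝ] ℂ) ((conjCLE : ℂ →L[ℝ] ℂ) z) = z := fun z => by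
    simp
  have h1 : ((1 : ℂ) • (conjCLE : ℂ →L[ℝ] ℂ)) = (conjCLE : ℂ →L[ℝ] ℂ) := one_smul _ _
  refine ⟨⟨linGerm p conjCLE, linGerm p conjCLE, linGerm_mul_self_of_involutive hinv,
    linGerm_mul_self_of_involutive hinv⟩, isAddCompat_linGerm _, ?_, ?_, ?_⟩
  · simpa [h1] using preservesOrthFrames_conjSmul (p := p) 1
  · simpa [h1] using not_preservesOrientation_conjSmul (p := p) 1
  · intro hu
    exact (by simpa [h1] using not_preservesOrientation_conjSmul (p := p) 1 : ¬ _)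
      ((mem_germAut _).1 hu).2.2

/-- **Independence, II (F-2666 ⇏ F-2665):** at every `p` there is a unit of `LocGerm p`, compatible with the
local additive structure and preserving the orientations, which does NOT preserve the orthogonal frames —
the shear germ `z ↦ p + S (z − p)`, `S z = z + (re z) · i` (inverse shear `z ↦ z − (re z) · i`).  So the
orthogonal-frame condition (Rmk. 2.5.1) in the definition of `𝒜_p` is not idle either.
[cite: MochizukiAbsTopIII2015, Proposition 2.6 (a) p.57] -/
theorem exists_unit_preservesOrientation_not_preservesOrthFrames (p : ℂ) :
    ∃ u : (LocGerm p)ˣ, (u : LocGerm p).IsAddCompat ∧ (u : LocGerm p).PreservesOrientation ∧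
      ¬ (u : LocGerm p).PreservesOrthFrames ∧ u ∉ germAut p := by
  set S : ℂ →L[ℝ] ℂ := ContinuousLinearMap.id ℝ ℂ + reCLM.smulRight I with hS
  set S' : ℂ →L[ℝ] ℂ := ContinuousLinearMap.id ℝ ℂ - reCLM.smulRight I with hS'
  have hS'apply : ∀ z : ℂ, S' z = z - (z.re : ℂ) * I := fun z => by
    simp [hS', Complex.reCLM_apply]
  have hSS' : ∀ z, S (S' z) = z := fun z => by
    rw [hS, shear_apply, hS'apply]
    apply Complex.ext <;> simp
  have hS'S : ∀ z, S' (S z) = z := fun z => by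
    rw [hS'apply, hS, shear_apply]
    apply Complex.ext <;> simp
  have hmul : linGerm p S * linGerm p S' = 1 := by
    rw [linGerm_mul, ← linGerm_id]
    congr 1
    ext1 z
    simp [hSS' z]
  have hmul' : linGerm p S' * linGerm p S = 1 := by
    rw [linGerm_mul, ← linGerm_id]
    congr 1
    ext1 z
    simp [hS'S z]
  refine ⟨⟨linGerm p S, linGerm p S', hmul, hmul'⟩, isAddCompat_linGerm _, preservesOrientation_shear,
    not_preservesOrthFrames_shear, fun hu => ?_⟩
  exact not_preservesOrthFrames_shear ((mem_germAut _).1 hu).2.1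

/-! ### The universal closures of the two rows are false -/

/-- **F-2665, universal closure REFUTED:** not every local germ preserves the orthogonal frames (the shear
germ at any point does not). [cite: MochizukiAbsTopIII2015, Proposition 2.6 (a) p.57] -/
theorem not_forall_preservesOrthFrames : ¬ ∀ (p : ℂ) (F : LocGerm p), F.PreservesOrthFrames :=
  fun h => not_preservesOrthFrames_shear (h 0 _)

/-- **F-2666, universal closure REFUTED:** not every local germ preserves the orientations (no conjugation
germ does; nor does the constant germ `mulGerm p 0`). [cite: MochizukiAbsTopIII2015, Proposition 2.6 (a) p.57] -/
theorem not_forall_preservesOrientation : ¬ ∀ (p : ℂ) (F : LocGerm p), F.PreservesOrientation :=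
  fun h => (preservesOrientation_mulGerm_iff (p := 0) 0).1 (h 0 _) rfl

/-- **F-2665, closure over the ambient group REFUTED:** not even every automorphism of the projective system
of neighbourhoods of `p` (unit of `LocGerm p`) preserves the orthogonal frames.
[cite: MochizukiAbsTopIII2015, Proposition 2.6 (a) p.57] -/
theorem not_forall_units_preservesOrthFrames :
    ¬ ∀ (p : ℂ) (u : (LocGerm p)ˣ), (u : LocGerm p).PreservesOrthFrames := by
  intro h
  obtain ⟨u, -, -, hu, -⟩ := exists_unit_preservesOrientation_not_preservesOrthFrames 0
  exact hu (h 0 u)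

/-- **F-2666, closure over the ambient group REFUTED:** not every automorphism of the projective system of
neighbourhoods of `p` preserves the orientations. [cite: MochizukiAbsTopIII2015, Proposition 2.6 (a) p.57] -/
theorem not_forall_units_preservesOrientation :
    ¬ ∀ (p : ℂ) (u : (LocGerm p)ˣ), (u : LocGerm p).PreservesOrientation := by
  intro h
  obtain ⟨u, -, -, hu, -⟩ := exists_unit_preservesOrthFrames_not_preservesOrientation 0
  exact hu (h 0 u)

end LocGerm

end Literature.AnabelianGeometry.AbsoluteAnabelian

end
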